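import Summits.HubbardSuperconductivity.HubbardSuperconductivity.Theorems.WeakCouplingBCSKlLindhardEnclosureCrude
import Summits.HubbardSuperconductivity.HubbardSuperconductivity.Theorems.WeakCouplingBCSKlLindhardEnclosureFloorRules
import Summits.HubbardSuperconductivity.HubbardSuperconductivity.Theorems.WeakCouplingBCSKlLindhardEnclosureCertW20C

/-!
# KL-MARGIN-SCAN reader (22) «kernel-lindhard-enclosure» — the gate theorems and the `W20` enclosure FROM THE FIVE REMAINING RULE PREDICATES

Bookkeeping capstone of today's soundness work: after the structural reductions (`…FloorStructural`, `…CeilStructuralOrd`), the rule splits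
(`…FloorRules`, `…CeilRulesOrd`), the records layer (`…CosRange`, `…CellSound`) and the two discharged ceiling rules (`…SameSide`, `…Crude`),
EVERY gate theorem of the instrument holds, for every certificate tree, from exactly FIVE rule-level predicates about one grid cell each:
floor side `FloorInsideSoundAt P` (Jensen floor), `FloorBdrySoundAt P` (boundary floor); ceiling side `CeilChordSoundOrd P` (chord),
`CeilBdrySoundOrd P` (majorised hyperbola), `CeilTipSoundOrd P` (tip).  Stated here: `sound_of_five_rules` (both named predicates of Gate §4 for
all trees), `hull_contains_of_five_rules`, and the certificate instance `W20_enclosure_of_five_rules` — the (22) witness `W20` now reads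
«`0.3287… ≤ χ₀(q_W20; −2399/2500, −3/10) ≤ 0.3462…` MODULO those five rule predicates at `P_W20`», records layer included.  Honest framing:
the five rule predicates are NOT proved; floats are floats; nothing in this file asserts a KL margin at any `t′ ≠ 0`, `K₃`, `U₀`, the window
or B1g dominance; a Kohn–Luttinger instability statement is not ODLRO and nothing here proves superconductivity in the Hubbard model.
(p1 g25, 2026-08-29.)
-/

noncomputable section

set_option linter.dupNamespace false

namespace Summit.HubbardSuperconductivity.HubbardSuperconductivity.Theorems.KlLindhardEnclosure

open Real Set MeasureTheory Literature.MathematicalPhysics.QuantumLattice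
open Summit.HubbardSuperconductivity.HubbardSuperconductivity.Theorems

/-- **BOTH NAMED PREDICATES OF THE GATE, for every tree, from the five remaining rule predicates.** -/
theorem sound_of_five_rules (P : Params) (hI : FloorInsideSoundAt P) (hB : FloorBdrySoundAt P) (hCh : CeilChordSoundOrd P)
    (hBd : CeilBdrySoundOrd P) (hT : CeilTipSoundOrd P) (t : QB) : FloorSoundAt P t ∧ CeilSoundAt P t :=
  ⟨floorSoundAt_of_rules P hI hB t, ceilSoundAt_of_three_rules P hCh hBd hT t⟩

/-- **THE CONTAINMENT GATE from the five rule predicates**: a hull row `[lo, hi]` confirmed by the kernel at the certificate's point holds for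
the true `χ₀` there. -/
theorem hull_contains_of_five_rules (P : Params) (hI : FloorInsideSoundAt P) (hB : FloorBdrySoundAt P) (hCh : CeilChordSoundOrd P)
    (hBd : CeilBdrySoundOrd P) (hT : CeilTipSoundOrd P) (t : QB) (hP : P.admissible = true) (Nf Nc : ℤ)
    (hE : P.rootEval t = (Nf, some Nc)) (lo hi : ℚ) (hlo : lo * (2 ^ 30 * (2 * KlStair.piUpQ) ^ 2) ≤ Nf)
    (hhi : (Nc : ℚ) ≤ hi * (2 ^ 30 * (2 * FSPoly.piLoQ) ^ 2)) : ((lo : ℚ) : ℝ) ≤ P.chi ∧ P.chi ≤ ((hi : ℚ) : ℝ) :=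
  hull_contains P t (floorSoundAt_of_rules P hI hB t) (ceilSoundAt_of_three_rules P hCh hBd hT t) hP Nf Nc hE lo hi hlo hhi

/-- **THE `W20` ENCLOSURE from the five rule predicates at `P_W20`**: `13934968926/(2³⁰(2·piUpQ)²) ≤ χ₀ ≤ 14677221910/(2³⁰(2·piLoQ)²)`. -/
theorem W20_enclosure_of_five_rules (hI : FloorInsideSoundAt P_W20) (hB : FloorBdrySoundAt P_W20) (hCh : CeilChordSoundOrd P_W20)
    (hBd : CeilBdrySoundOrd P_W20) (hT : CeilTipSoundOrd P_W20) :
    ((13934968926 : ℤ) : ℝ) / (2 ^ 30 * (2 * ((KlStair.piUpQ : ℚ) : ℝ)) ^ 2) ≤ P_W20.chi ∧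
    P_W20.chi ≤ ((14677221910 : ℤ) : ℝ) / (2 ^ 30 * (2 * ((FSPoly.piLoQ : ℚ) : ℝ)) ^ 2) :=
  W20_enclosure (floorSoundAt_of_rules P_W20 hI hB T_W20) (ceilSoundAt_of_three_rules P_W20 hCh hBd hT T_W20)

end Summit.HubbardSuperconductivity.HubbardSuperconductivity.Theorems.KlLindhardEnclosure

end
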